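import Summits.CriticalPhenomena.PercolationContinuityZ3.Theorems.PercNearOneGluingNoHeavyLowerTailBHKRowRandomCluster
import Summits.CriticalPhenomena.PercolationContinuityZ3.Theorems.PercNearOneGluingNoHeavyLowerTailKNGoodTwoMarkCells
import Literature.Barriers.CriticalPhenomena.GaussianDominationRouteDiagramsProofs
import HarnessLib

/-!
# `NoHeavyLowerTail` (stmt-CriticalPhenomena-4575) — the pivotal cells for the random-cluster measure: the three-event dictionary at
# configuration level and the inputs of the dual-row chains for `φ_{𝐩,q}`, `q ≥ 1`

Support file (prover prim-gen-kcluster gen 48; `--supports stmt-CriticalPhenomena-4575`).  No named facts, no sorries, no definitions.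
Part IV of the pivotal refinement (`…PivotalThreeEvents`) identified, for product measures and in the finitary `PrW` vocabulary, the
coarse cells `q, u_a, u_b, u_c, T_a, T_b, T_c, T₀` with the eight atoms of the three increasing events `H_a = {b ↔ c off a}`,
`H_b = {a ↔ c off b}`, `H_c = {a ↔ b off c}`.  Here the same dictionary is proved at the level of CONFIGURATIONS (`BondConfig V`,
any vertex type; `pivCell_iff`, `apartCell_iff`, `sideCell_iff` — the tool is the "first visit to `{y, z}`" lemma
`reachable_delVertex_or_of_reachable`), so that it can be read under ANY measure, and the five inputs of the dual-row chains of parts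
VI–VII (two BHK rows + three Harris inequalities) are supplied for the random-cluster measure `rcMeasureW w q ∅`, every `q ≥ 1`:
the BHK rows from `bhkRow_rcMeasureW` (this gen, split-vertex vdBHK) and Harris replaced by FKG (`rcMeasureW_fkg`)
(`dualRow_inputs_rcMeasureW`).  Consumed by `…PivotalDualRowsRandomCluster.lean` (dR3, dR4⁺, positive correlation for `q ≥ 1`).
[cite: VandenbergHaggstromKahn2005, Thm. 1.4 (p. 7); Grimmett2006, Thm. (3.8)]
-/

noncomputable section

namespace Summit.CriticalPhenomena.PercolationContinuityZ3.Theorems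

namespace PivotalBHK

open Literature.Probability.Percolation Literature.Probability.Percolation.BHK2006
open MeasureTheory Literature.Probability.LatticeModels SimpleGraph
open scoped Classical

section Graph

variable {V : Type*}

/-- Deleting two vertices in either order gives the same configuration. [folklore] -/
theorem delVertex_comm (y z : V) (ω : BondConfig V) :
    delVertex y (delVertex z ω) = delVertex z (delVertex y ω) := by
  ext e; simp only [mem_delVertex_iff]; tauto

/-- **First visit to `{y, z}`.**  An open path from `x` to `y` either avoids `z` (then `x ↔ y` off `z`)
or meets `z` before it meets `y` (then `x ↔ z` off `y`); `x, y, z` pairwise distinct. [folklore] -/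
theorem reachable_delVertex_or_of_reachable {ω : BondConfig V} {x y z : V} (hxy : x ≠ y)
    (hxz : x ≠ z) (hyz : y ≠ z) (h : (openGraph ω).Reachable x y) :
    (openGraph (delVertex z ω)).Reachable x y ∨ (openGraph (delVertex y ω)).Reachable x z := by
  rw [SimpleGraph.reachable_iff_reflTransGen] at h
  -- invariant along the walk: the walk so far avoids `y` and `z`, or one of the conclusions holds
  have key : ∀ u, Relation.ReflTransGen (openGraph ω).Adj x u →
      (openGraph (delVertex y (delVertex z ω))).Reachable x u ∨
        ((openGraph (delVertex z ω)).Reachable x y ∨ (openGraph (delVertex y ω)).Reachable x z) := by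
    intro u hu
    induction hu with
    | refl => exact Or.inl (Reachable.refl x)
    | @tail u v _ huv ih =>
      rcases ih with ih | ih
      · obtain ⟨hω, hne⟩ := (openGraph_adj ω u v).1 huv
        -- `u` is joined to `x` off `y, z`, so `u ≠ y`, `u ≠ z`
        have huy : u ≠ y := by
          rintro rfl
          exact hxy (eq_of_reachable_delVertex ih)
        have huz : u ≠ z := by
          rintro rfl
          rw [delVertex_comm] at ih
          exact hxz (eq_of_reachable_delVertex ih)
        have ihz : (openGraph (delVertex z ω)).Reachable x u :=
          ih.mono (openGraph_le (delVertex_subset y (delVertex z ω)))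
        have ihy : (openGraph (delVertex y ω)).Reachable x u := by
          rw [delVertex_comm] at ih
          exact ih.mono (openGraph_le (delVertex_subset z (delVertex y ω)))
        by_cases hvy : v = y
        · subst hvy
          exact Or.inr (Or.inl (ihz.trans (Adj.reachable
            ((openGraph_delVertex_adj z ω u v).2 ⟨hω, huz, hyz, hne⟩))))
        · by_cases hvz : v = z
          · subst hvz
            exact Or.inr (Or.inr (ihy.trans (Adj.reachable
              ((openGraph_delVertex_adj y ω u v).2 ⟨hω, huy, Ne.symm hyz, hne⟩))))
          · refine Or.inl (ih.trans (Adj.reachable ?_))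
            rw [openGraph_delVertex_adj]
            exact ⟨⟨hω, fun h => (Sym2.mem_iff.1 h).elim (Ne.symm huz) (Ne.symm hvz)⟩, huy, hvy, hne⟩
      · exact Or.inr ih
  rcases key y h with h1 | h1
  · exact absurd (eq_of_reachable_delVertex h1) hxy
  · exact h1

/-- Monotonicity: joined off `z` implies joined. [folklore] -/
theorem reachable_of_reachable_delVertex {ω : BondConfig V} {x y z : V}
    (h : (openGraph (delVertex z ω)).Reachable x y) : (openGraph ω).Reachable x y :=
  h.mono (openGraph_le (delVertex_subset z ω))

/-- `{y ↔ z off x}` is an increasing event. [folklore] -/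
theorem isUpperSet_offConn (x y z : V) :
    IsUpperSet {ω : BondConfig V | {e | e ∈ ω ∧ x ∉ e} ∈ openConn y z} := by
  intro ω ω' hωω' h
  exact Reachable.mono (openGraph_le (delVertex_mono x hωω')) h

end Graph

/-! ### The three-event dictionary at configuration level: atoms of `(H_a, H_b, H_c)` = the coarse cells -/

section Dictionary

variable {V : Type*} {a b c : V}

/-- **The `a`-pivotal cell**: `a ↔ b`, `a ↔ c` and `b ↮ c` off `a` iff `¬H_a ∧ H_b ∧ H_c`
(`H_a = {b ↔ c off a}`, `H_b = {a ↔ c off b}`, `H_c = {a ↔ b off c}`). [folklore] -/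
theorem pivCell_iff (hab : a ≠ b) (hac : a ≠ c) (hbc : b ≠ c) (ω : BondConfig V) :
    ((openGraph ω).Reachable a b ∧ (openGraph ω).Reachable a c ∧
        ¬ (openGraph (delVertex a ω)).Reachable b c) ↔
      (¬ (openGraph (delVertex a ω)).Reachable b c ∧ (openGraph (delVertex b ω)).Reachable a c ∧
        (openGraph (delVertex c ω)).Reachable a b) := by
  constructor
  · rintro ⟨h1, h2, h3⟩
    refine ⟨h3, ?_, ?_⟩
    · rcases reachable_delVertex_or_of_reachable (Ne.symm hac) (Ne.symm hbc) hab h2.symm with h | h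
      · exact h.symm
      · exact absurd h.symm h3
    · rcases reachable_delVertex_or_of_reachable (Ne.symm hab) hbc hac h1.symm with h | h
      · exact h.symm
      · exact absurd h h3
  · rintro ⟨h3, h2, h1⟩
    exact ⟨reachable_of_reachable_delVertex h1, reachable_of_reachable_delVertex h2, h3⟩

/-- **The all-separate cell**: `a ↮ b`, `a ↮ c`, `b ↮ c` iff `¬H_a ∧ ¬H_b ∧ ¬H_c`. [folklore] -/
theorem apartCell_iff (hab : a ≠ b) (hac : a ≠ c) (hbc : b ≠ c) (ω : BondConfig V) :
    (¬ (openGraph ω).Reachable a b ∧ ¬ (openGraph ω).Reachable a c ∧ ¬ (openGraph ω).Reachable b c) ↔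
      (¬ (openGraph (delVertex a ω)).Reachable b c ∧ ¬ (openGraph (delVertex b ω)).Reachable a c ∧
        ¬ (openGraph (delVertex c ω)).Reachable a b) := by
  constructor
  · rintro ⟨h1, h2, h3⟩
    exact ⟨fun h => h3 (reachable_of_reachable_delVertex h),
      fun h => h2 (reachable_of_reachable_delVertex h), fun h => h1 (reachable_of_reachable_delVertex h)⟩
  · rintro ⟨h3, h2, h1⟩
    refine ⟨fun h => ?_, fun h => ?_, fun h => ?_⟩
    · rcases reachable_delVertex_or_of_reachable hab hac hbc h with h' | h'
      · exact h1 h'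
      · exact h2 h'
    · rcases reachable_delVertex_or_of_reachable hac hab (Ne.symm hbc) h with h' | h'
      · exact h2 h'
      · exact h1 h'
    · rcases reachable_delVertex_or_of_reachable hbc (Ne.symm hab) (Ne.symm hac) h with h' | h'
      · exact h3 h'
      · exact h1 h'.symm

/-- **The cell `ac|b`**: `a ↔ c` and `a ↮ b` iff `H_b ∧ ¬H_a ∧ ¬H_c`. [folklore] -/
theorem sideCell_iff (hab : a ≠ b) (hac : a ≠ c) (hbc : b ≠ c) (ω : BondConfig V) :
    ((openGraph ω).Reachable a c ∧ ¬ (openGraph ω).Reachable a b) ↔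
      ((openGraph (delVertex b ω)).Reachable a c ∧ ¬ (openGraph (delVertex a ω)).Reachable b c ∧
        ¬ (openGraph (delVertex c ω)).Reachable a b) := by
  constructor
  · rintro ⟨h1, h2⟩
    refine ⟨reachable_delVertex_of_not_reachable h1 h2, fun h => h2 ?_,
      fun h => h2 (reachable_of_reachable_delVertex h)⟩
    exact h1.trans (reachable_of_reachable_delVertex h).symm
  · rintro ⟨h1, h2, h3⟩
    refine ⟨reachable_of_reachable_delVertex h1, fun h => ?_⟩
    rcases reachable_delVertex_or_of_reachable (Ne.symm hab) hbc hac h.symm with h' | h'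
    · exact h3 h'.symm
    · exact h2 h'

end Dictionary

/-! ### The dual rows dR3, dR4⁺ and the positive correlation for `φ_{𝐩,q}`, `q ≥ 1` -/

section Rows

variable {V : Type*} [Fintype V]

/-- **The inputs of the dual-row chains for `φ_{𝐩,q}`, `q ≥ 1`, on the atoms of `(H_a, H_b, H_c)`.**
With `H_a = {b ↔ c off a}`, `H_b = {a ↔ c off b}`, `H_c = {a ↔ b off c}` (increasing events) and
`φ = rcMeasureW w q ∅`: the two BHK rows `φ(¬H_a¬H_b¬H_c)·φ(¬H_a H_b H_c) ≤ φ(¬H_a H_b ¬H_c)·φ(¬H_a ¬H_b H_c)`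
(at `a`), `φ(¬H_a¬H_b¬H_c)·φ(H_a ¬H_b H_c) ≤ φ(H_a ¬H_b ¬H_c)·φ(¬H_a ¬H_b H_c)` (at `b`) and
`φ(¬H_a¬H_b¬H_c)·φ(H_a H_b ¬H_c) ≤ φ(H_a ¬H_b ¬H_c)·φ(¬H_a H_b ¬H_c)` (at `c`)
(`bhkRow_rcMeasureW` read through the three-event dictionary), and the FKG inequalities
`φ(H_b¬H_a)·φ(H_a¬H_b) ≤ φ(H_aH_b)·φ(¬H_a¬H_b)`, `φ(H_c¬H_a) ≤ φ(H_c)·φ(¬H_a)`,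
`φ(H_c)·φ(H_aH_b) ≤ φ(H_aH_bH_c)`, `φ(H_c)·φ(H_a) ≤ φ(H_aH_c)`, `φ(H_a¬H_b¬H_c) ≤ φ(H_a)·φ(¬H_b¬H_c)`
(`rcMeasureW_fkg`; the last one is Harris for the increasing `H_a` and the decreasing `{a apart} = ¬H_b ∩ ¬H_c`).
[cite: VandenbergHaggstromKahn2005, Thm. 1.4 (p. 7); Grimmett2006, Thm. (3.8)] -/
theorem dualRow_inputs_rcMeasureW (w : Sym2 V → unitInterval) {q : ℝ} (hq : 1 ≤ q) {a b c : V}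
    (hab : a ≠ b) (hac : a ≠ c) (hbc : b ≠ c) :
    let μ := rcMeasureW w q ∅
    let Ha : Set (BondConfig V) := {ω | {e | e ∈ ω ∧ a ∉ e} ∈ openConn b c}
    let Hb : Set (BondConfig V) := {ω | {e | e ∈ ω ∧ b ∉ e} ∈ openConn a c}
    let Hc : Set (BondConfig V) := {ω | {e | e ∈ ω ∧ c ∉ e} ∈ openConn a b}
    (μ.real (Haᶜ ∩ Hbᶜ ∩ Hcᶜ) * μ.real (Haᶜ ∩ Hb ∩ Hc) ≤
        μ.real (Haᶜ ∩ Hb ∩ Hcᶜ) * μ.real (Haᶜ ∩ Hbᶜ ∩ Hc)) ∧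
      (μ.real (Haᶜ ∩ Hbᶜ ∩ Hcᶜ) * μ.real (Ha ∩ Hbᶜ ∩ Hc) ≤
        μ.real (Ha ∩ Hbᶜ ∩ Hcᶜ) * μ.real (Haᶜ ∩ Hbᶜ ∩ Hc)) ∧
      (μ.real (Haᶜ ∩ Hb) * μ.real (Ha ∩ Hbᶜ) ≤ μ.real (Ha ∩ Hb) * μ.real (Haᶜ ∩ Hbᶜ)) ∧
      (μ.real (Hc ∩ Haᶜ) ≤ μ.real Hc * μ.real Haᶜ) ∧
      (μ.real Hc * μ.real (Ha ∩ Hb) ≤ μ.real (Ha ∩ Hb ∩ Hc)) ∧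
      (μ.real Hc * μ.real Ha ≤ μ.real (Ha ∩ Hc)) ∧
      (μ.real (Haᶜ ∩ Hbᶜ ∩ Hcᶜ) * μ.real (Ha ∩ Hb ∩ Hcᶜ) ≤
        μ.real (Ha ∩ Hbᶜ ∩ Hcᶜ) * μ.real (Haᶜ ∩ Hb ∩ Hcᶜ)) ∧
      (μ.real (Ha ∩ (Hbᶜ ∩ Hcᶜ)) ≤ μ.real Ha * μ.real (Hbᶜ ∩ Hcᶜ)) := by
  intro μ Ha Hb Hc
  have hq0 : 0 < q := one_pos.trans_le hq
  haveI : IsProbabilityMeasure μ := isProbabilityMeasure_rcMeasureW w hq0 ∅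
  have uA : IsUpperSet Ha := isUpperSet_offConn a b c
  have uB : IsUpperSet Hb := isUpperSet_offConn b a c
  have uC : IsUpperSet Hc := isUpperSet_offConn c a b
  -- the two BHK rows, read on the atoms
  have rowa := bhkRow_rcMeasureW w hq hab hac
  have rowb := bhkRow_rcMeasureW w hq (Ne.symm hab) hbc
  have eQa : ((openConn a b)ᶜ ∩ (openConn a c)ᶜ ∩ (openConn b c)ᶜ : Set (BondConfig V)) =
      Haᶜ ∩ Hbᶜ ∩ Hcᶜ := by
    ext ω
    simp only [Set.mem_inter_iff, Set.mem_compl_iff, Ha, Hb, Hc, Set.mem_setOf_eq]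
    have h := apartCell_iff hab hac hbc ω
    constructor
    · rintro ⟨⟨h1, h2⟩, h3⟩
      obtain ⟨k1, k2, k3⟩ := h.1 ⟨h1, h2, h3⟩
      exact ⟨⟨k1, k2⟩, k3⟩
    · rintro ⟨⟨k1, k2⟩, k3⟩
      obtain ⟨h1, h2, h3⟩ := h.2 ⟨k1, k2, k3⟩
      exact ⟨⟨h1, h2⟩, h3⟩
  have eQb : ((openConn b a)ᶜ ∩ (openConn b c)ᶜ ∩ (openConn a c)ᶜ : Set (BondConfig V)) =
      Haᶜ ∩ Hbᶜ ∩ Hcᶜ := by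
    rw [← eQa, Literature.Barriers.CriticalPhenomena.openConn_comm' b a]
    ext ω; simp only [Set.mem_inter_iff, Set.mem_compl_iff]; tauto
  have eTa : {ω : BondConfig V | ω ∈ openConn a b ∧ ω ∈ openConn a c ∧
      {e | e ∈ ω ∧ a ∉ e} ∉ openConn b c} = Haᶜ ∩ Hb ∩ Hc := by
    ext ω
    simp only [Set.mem_inter_iff, Set.mem_compl_iff, Ha, Hb, Hc, Set.mem_setOf_eq]
    have h := pivCell_iff hab hac hbc ω
    constructor
    · intro h'
      obtain ⟨k1, k2, k3⟩ := h.1 h'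
      exact ⟨⟨k1, k2⟩, k3⟩
    · rintro ⟨⟨k1, k2⟩, k3⟩
      exact h.2 ⟨k1, k2, k3⟩
  have eTb : {ω : BondConfig V | ω ∈ openConn b a ∧ ω ∈ openConn b c ∧
      {e | e ∈ ω ∧ b ∉ e} ∉ openConn a c} = Ha ∩ Hbᶜ ∩ Hc := by
    ext ω
    simp only [Set.mem_inter_iff, Set.mem_compl_iff, Ha, Hb, Hc, Set.mem_setOf_eq]
    have h := pivCell_iff (Ne.symm hab) hbc hac ω
    -- at `b`: (b↔a ∧ b↔c ∧ ¬(a↔c off b)) ↔ (¬(a↔c off b) ∧ (b↔c off a) ∧ (b↔a off c))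
    constructor
    · intro h'
      obtain ⟨k1, k2, k3⟩ := h.1 h'
      exact ⟨⟨k2, k1⟩, k3.symm⟩
    · rintro ⟨⟨k2, k1⟩, k3⟩
      exact h.2 ⟨k1, k2, k3.symm⟩
  have eUb : (openConn a c ∩ (openConn a b)ᶜ : Set (BondConfig V)) = Haᶜ ∩ Hb ∩ Hcᶜ := by
    ext ω
    simp only [Set.mem_inter_iff, Set.mem_compl_iff, Ha, Hb, Hc, Set.mem_setOf_eq]
    have h := sideCell_iff hab hac hbc ω
    constructor
    · intro h'
      obtain ⟨k1, k2, k3⟩ := h.1 h'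
      exact ⟨⟨k2, k1⟩, k3⟩
    · rintro ⟨⟨k2, k1⟩, k3⟩
      exact h.2 ⟨k1, k2, k3⟩
  have eUc : (openConn a b ∩ (openConn a c)ᶜ : Set (BondConfig V)) = Haᶜ ∩ Hbᶜ ∩ Hc := by
    ext ω
    simp only [Set.mem_inter_iff, Set.mem_compl_iff, Ha, Hb, Hc, Set.mem_setOf_eq]
    have h := sideCell_iff hac hab (Ne.symm hbc) ω
    -- with `b, c` exchanged: (a↔b ∧ a↮c) ↔ ((a↔b off c) ∧ ¬(c↔b off a) ∧ ¬(a↔c off b))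
    constructor
    · intro h'
      obtain ⟨k1, k2, k3⟩ := h.1 h'
      exact ⟨⟨fun h'' => k2 h''.symm, k3⟩, k1⟩
    · rintro ⟨⟨k2, k3⟩, k1⟩
      exact h.2 ⟨k1, fun h'' => k2 h''.symm, k3⟩
  have eUa : (openConn b c ∩ (openConn b a)ᶜ : Set (BondConfig V)) = Ha ∩ Hbᶜ ∩ Hcᶜ := by
    ext ω
    simp only [Set.mem_inter_iff, Set.mem_compl_iff, Ha, Hb, Hc, Set.mem_setOf_eq]
    have h := sideCell_iff (Ne.symm hab) hbc hac ω
    -- at `b`: (b↔c ∧ b↮a) ↔ ((b↔c off a) ∧ ¬(a↔c off b) ∧ ¬(b↔a off c))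
    constructor
    · intro h'
      obtain ⟨k1, k2, k3⟩ := h.1 h'
      exact ⟨⟨k1, k2⟩, fun h'' => k3 h''.symm⟩
    · rintro ⟨⟨k1, k2⟩, k3⟩
      exact h.2 ⟨k1, k2, fun h'' => k3 h''.symm⟩
  have eUc' : (openConn b a ∩ (openConn b c)ᶜ : Set (BondConfig V)) = Haᶜ ∩ Hbᶜ ∩ Hc := by
    rw [← eUc, Literature.Barriers.CriticalPhenomena.openConn_comm' b a]
    ext ω
    simp only [Set.mem_inter_iff, Set.mem_compl_iff]
    constructor
    · rintro ⟨h1, h2⟩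
      exact ⟨h1, fun h3 => h2 ((show (openGraph ω).Reachable a b from h1).symm.trans h3)⟩
    · rintro ⟨h1, h2⟩
      exact ⟨h1, fun h3 => h2 ((show (openGraph ω).Reachable a b from h1).trans h3)⟩
  rw [eQa, eTa, eUb, eUc] at rowa
  rw [eQb, eTb, eUa, eUc'] at rowb
  -- the BHK row at `c`
  have rowc := bhkRow_rcMeasureW w hq (Ne.symm hac) (Ne.symm hbc)
  have eQc : ((openConn c a)ᶜ ∩ (openConn c b)ᶜ ∩ (openConn a b)ᶜ : Set (BondConfig V)) =
      Haᶜ ∩ Hbᶜ ∩ Hcᶜ := by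
    rw [← eQa, Literature.Barriers.CriticalPhenomena.openConn_comm' c a, Literature.Barriers.CriticalPhenomena.openConn_comm' c b]
    ext ω; simp only [Set.mem_inter_iff, Set.mem_compl_iff]; tauto
  have eTc : {ω : BondConfig V | ω ∈ openConn c a ∧ ω ∈ openConn c b ∧
      {e | e ∈ ω ∧ c ∉ e} ∉ openConn a b} = Ha ∩ Hb ∩ Hcᶜ := by
    ext ω
    simp only [Set.mem_inter_iff, Set.mem_compl_iff, Ha, Hb, Hc, Set.mem_setOf_eq]
    have h := pivCell_iff (Ne.symm hac) (Ne.symm hbc) hab ω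
    -- at `c`: (c↔a ∧ c↔b ∧ ¬(a↔b off c)) ↔ (¬(a↔b off c) ∧ (c↔b off a) ∧ (c↔a off b))
    constructor
    · intro h'
      obtain ⟨k1, k2, k3⟩ := h.1 h'
      exact ⟨⟨k2.symm, k3.symm⟩, k1⟩
    · rintro ⟨⟨k2, k3⟩, k1⟩
      exact h.2 ⟨k1, k2.symm, k3.symm⟩
  have eUa' : (openConn c b ∩ (openConn c a)ᶜ : Set (BondConfig V)) = Ha ∩ Hbᶜ ∩ Hcᶜ := by
    ext ω
    simp only [Set.mem_inter_iff, Set.mem_compl_iff, Ha, Hb, Hc, Set.mem_setOf_eq]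
    have h := sideCell_iff (Ne.symm hac) (Ne.symm hbc) hab ω
    -- at `c`: (c↔b ∧ c↮a) ↔ ((c↔b off a) ∧ ¬(a↔b off c) ∧ ¬(c↔a off b))
    constructor
    · intro h'
      obtain ⟨k1, k2, k3⟩ := h.1 h'
      exact ⟨⟨k1.symm, fun h'' => k3 h''.symm⟩, k2⟩
    · rintro ⟨⟨k1, k3⟩, k2⟩
      exact h.2 ⟨k1.symm, k2, fun h'' => k3 h''.symm⟩
  have eUb' : (openConn c a ∩ (openConn c b)ᶜ : Set (BondConfig V)) = Haᶜ ∩ Hb ∩ Hcᶜ := by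
    ext ω
    simp only [Set.mem_inter_iff, Set.mem_compl_iff, Ha, Hb, Hc, Set.mem_setOf_eq]
    have h := sideCell_iff (Ne.symm hbc) (Ne.symm hac) (Ne.symm hab) ω
    -- `sideCell_iff` at `(c; b, a)`: (c↔a ∧ c↮b) ↔ ((c↔a off b) ∧ ¬(b↔a off c) ∧ ¬(c↔b off a))
    constructor
    · intro h'
      obtain ⟨k1, k2, k3⟩ := h.1 h'
      exact ⟨⟨fun h'' => k3 h''.symm, k1.symm⟩, fun h'' => k2 h''.symm⟩
    · rintro ⟨⟨k3, k1⟩, k2⟩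
      exact h.2 ⟨k1.symm, fun h'' => k2 h''.symm, fun h'' => k3 h''.symm⟩
  rw [eQc, eTc, eUa', eUb'] at rowc
  -- FKG three times
  have f1 := rcMeasureW_fkg w hq ∅ uA uB
  have f2 := rcMeasureW_fkg w hq ∅ uC uA
  have f3 := rcMeasureW_fkg w hq ∅ uC (uA.inter uB)
  have f4 := rcMeasureW_fkg w hq ∅ uA (uB.union uC)
  refine ⟨rowa, rowb, ?_, ?_, ?_, by rw [Set.inter_comm]; exact f2, rowc, ?_⟩
  · -- `P(H_b¬H_a) P(H_a¬H_b) ≤ P(H_aH_b) P(¬H_a¬H_b)` ⟸ `P(H_a)P(H_b) ≤ P(H_aH_b)`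
    have sA := KNGoodTwoMark.real_split μ Ha Hb
    have sB : μ.real Hb = μ.real (Ha ∩ Hb) + μ.real (Haᶜ ∩ Hb) := by
      rw [KNGoodTwoMark.real_split μ Hb Ha, Set.inter_comm Hb Ha, Set.inter_comm Hb Haᶜ]
    have sAc := KNGoodTwoMark.real_split μ Haᶜ Hb
    have total : μ.real Ha + μ.real Haᶜ = 1 := by
      rw [probReal_compl_eq_one_sub (MeasurableSet.of_discrete)]; ring
    have h2 : μ.real (Ha ∩ Hb) * (μ.real Ha + μ.real Haᶜ) = μ.real (Ha ∩ Hb) := by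
      rw [total, mul_one]
    rw [sA, sAc] at h2
    rw [sA, sB] at f1
    nlinarith [f1, h2]
  · -- `P(H_c¬H_a) ≤ P(H_c) P(¬H_a)` ⟸ `P(H_c)P(H_a) ≤ P(H_cH_a)`
    have e : μ.real (Hc ∩ Haᶜ) = μ.real Hc - μ.real (Hc ∩ Ha) := by
      rw [KNGoodTwoMark.real_split μ Hc Ha]; ring
    rw [probReal_compl_eq_one_sub (MeasurableSet.of_discrete), e]
    nlinarith [f2]
  · -- `P(H_c) P(H_aH_b) ≤ P(H_aH_bH_c)`
    have e1 : Hc ∩ (Ha ∩ Hb) = Ha ∩ Hb ∩ Hc := by ext ω; simp only [Set.mem_inter_iff]; tauto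
    rw [← e1]; exact f3
  · -- `P(H_a ¬H_b ¬H_c) ≤ P(H_a) P(¬H_b ¬H_c)` ⟸ `P(H_a) P(H_b ∪ H_c) ≤ P(H_a ∩ (H_b ∪ H_c))`
    have e : μ.real (Ha ∩ (Hbᶜ ∩ Hcᶜ)) = μ.real Ha - μ.real (Ha ∩ (Hb ∪ Hc)) := by
      rw [KNGoodTwoMark.real_split μ Ha (Hb ∪ Hc), Set.compl_union]; ring
    have e' : μ.real (Hbᶜ ∩ Hcᶜ) = 1 - μ.real (Hb ∪ Hc) := by
      rw [← Set.compl_union, probReal_compl_eq_one_sub (MeasurableSet.of_discrete)]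
    rw [e, e']
    nlinarith [f4]

end Rows

end PivotalBHK

end Summit.CriticalPhenomena.PercolationContinuityZ3.Theorems

end
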